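import Summits.CriticalPhenomena.PercolationContinuityZ3.Theorems.PercNearOneGluingNoHeavyLowerTailIncStarApexUnicyclic
import Summits.CriticalPhenomena.PercolationContinuityZ3.Theorems.PercNearOneGluingNoHeavyLowerTailIncStarRootPairWalks
import HarnessLib

/-!
# The increasing star beyond one environment cycle: locality and block composition

Support file for the Sahi programme (`--supports stmt-CriticalPhenomena-4575`, prover prim-sahi-p2 gen 22).  No definitions, no named
facts, no sorries; standard axioms.  Memo `run/shared/lean/prim/prim-sahi/prim-sahi-p2/PROOF-E3.md` §32.

Gen 21's `IncStar.incStar_nonneg_of_apexUnicyclic` proves Sahi's cubic `E₃({s↔a},{s↔b},{s↔c}) ≥ 0` for product Bernoulli percolation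
whenever the ENVIRONMENT `H(w) = {z : s ∉ z, w z ≠ 0}` (the positive pairs avoiding the root) has at most one cycle.  This file removes
the cycles that cannot matter:

* `incStar_openConnIn_nonneg_of_apexUnicyclic` — RELATIVE form: for a vertex set `K ∋ r` and targets in `K`, the cubic of the events
  `{r ↔ t inside K}` under `prodBernoulli w` is `≥ 0` as soon as the pairs INSIDE `K` avoiding `r` form a forest plus at most one pair
  (weights outside `K` arbitrary).  Proof: the events are determined by the pairs inside `K` (`real_restrict_eq_of_determinedBy`:
  zero the other weights), under the restricted weight they are a.s. the plain root connections (`bridge_conn_ll`), and gen 21 applies.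
  This is the shape consumed by the cut-vertex composition theorem `IncStarCutVertex.incStar_openConnIn_of_cutVertex` (gen 8).
* `incStar_nonneg_of_target_split` — if a set `K ∋ s` is CLOSED (no positive pair from `K ∖ {s}` to `Kᶜ`) and separates one target
  from the other two, then `E₃ ≥ 0` for EVERY environment (independence of the two sides + Harris): cycles are harmless unless all
  three targets see them.
* `incStar_nonneg_of_localUnicyclic` — if a closed `K ∋ s` contains the three targets and the environment INSIDE `K` has at most one
  cycle, then `E₃ ≥ 0` (cycles of `H(w)` outside the targets' part are irrelevant).
* `incStar_nonneg_of_cutVertex_apexUnicyclic` — BLOCK COMPOSITION: `V = V₁ ∪ V₂` meeting in a cut vertex `x`, root `s ∈ V₁`, no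
  positive pair between `V₁ ∖ {x}` and `V₂ ∖ {x}`; if the pairs inside `V₁` avoiding `s` have at most one cycle and the pairs inside `V₂`
  avoiding `x` have at most one cycle, then `E₃ ≥ 0` for all targets — although `H(w)` may carry up to `1 + (1 + deg x)`-many
  independent cycles (e.g. a `K₄` hanging off an apex-unicyclic graph).  Iterate along the block–cut tree with the relative form.

Consequence (memo §32): a minimal weight violating the increasing star has its three targets in ONE closed part whose own environment
has cyclomatic number `≥ 2`, and that part is 2-connected through the root in the sense that no cut vertex `x ≠ s` splits it into
apex-unicyclic blocks.
-/

noncomputable section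

namespace Summit.CriticalPhenomena.PercolationContinuityZ3.Theorems

namespace IncStar

open MeasureTheory Set Literature.Probability.Percolation Literature.Probability.LatticeModels EdgeInduction
open Literature.Probability.Percolation.BlockExploration (mem_openConn_iff_openConnIn_univ)
open scoped Classical

variable {n : ℕ}

/-! ### Plumbing -/

/-- `E₃` of three events determined by a set `D` of pairs is unchanged when the weights outside `D` are zeroed. [folklore] -/
theorem sahiE3_restrict_eq_of_determinedBy (w : Sym2 (Fin n) → unitInterval) {D : Set (Sym2 (Fin n))}
    {A B C : Set (BondConfig (Fin n))} (hA : DeterminedBy A D) (hB : DeterminedBy B D) (hC : DeterminedBy C D) :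
    sahiE3 (prodBernoulli fun z => if z ∈ D then w z else 0) A B C = sahiE3 (prodBernoulli w) A B C := by
  rw [sahiE3_def, sahiE3_def, real_restrict_eq_of_determinedBy hA w, real_restrict_eq_of_determinedBy hB w,
    real_restrict_eq_of_determinedBy hC w, real_restrict_eq_of_determinedBy (hA.inter hB) w,
    real_restrict_eq_of_determinedBy (hA.inter hC) w, real_restrict_eq_of_determinedBy (hB.inter hC) w,
    real_restrict_eq_of_determinedBy ((hA.inter hB).inter hC) w]

/-- `insert r (K ∖ {r}) = K` for `r ∈ K`. [folklore] -/
theorem insert_diff_singleton_of_mem {K : Set (Fin n)} {r : Fin n} (hr : r ∈ K) : insert r (K \ {r}) = K := by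
  rw [Set.insert_sdiff_singleton, Set.insert_eq_of_mem hr]

/-- A vertex outside `K ∖ {r}` other than `r` is outside `K`. [folklore] -/
theorem not_mem_of_not_mem_diff_singleton {K : Set (Fin n)} {r y : Fin n} (hy : y ∉ K \ {r}) (hyr : y ≠ r) : y ∉ K :=
  fun h => hy ⟨h, by rwa [Set.mem_singleton_iff]⟩

/-! ### The relative form of the apex-unicyclic theorem -/

/-- **The increasing star inside a vertex set (relative apex-unicyclic theorem).**  Let `r ∈ K` and `a, b, c ∈ K`.  If the pairs
inside `K` avoiding `r` and of positive weight form a forest after deleting one pair `z₀`, then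
`0 ≤ E₃({r ↔ a in K}, {r ↔ b in K}, {r ↔ c in K})` under `prodBernoulli w` — whatever the weights outside `K`. [this work] -/
theorem incStar_openConnIn_nonneg_of_apexUnicyclic (w : Sym2 (Fin n) → unitInterval) {K : Set (Fin n)} {r a b c : Fin n}
    (hr : r ∈ K) (ha : a ∈ K) (hb : b ∈ K) (hc : c ∈ K) (z₀ : Sym2 (Fin n))
    (hforest : ((SimpleGraph.fromEdgeSet {z : Sym2 (Fin n) | r ∉ z ∧ (∀ v ∈ z, v ∈ K) ∧ w z ≠ 0}).deleteEdges {z₀}).IsAcyclic) :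
    0 ≤ sahiE3 (prodBernoulli w) (openConnIn K r a) (openConnIn K r b) (openConnIn K r c) := by
  -- the determining set of pairs and the restricted weight
  set D : Set (Sym2 (Fin n)) := {z : Sym2 (Fin n) | ¬ z.IsDiag ∧ ∀ v ∈ z, v ∈ K} with hD
  -- (the `if` is the classical one, as in `real_restrict_eq_of_determinedBy`)
  set wK : Sym2 (Fin n) → unitInterval := fun z => @ite _ (z ∈ D) (Classical.propDecidable _) (w z) 0 with hwK
  have hwKz : ∀ z, wK z = @ite _ (z ∈ D) (Classical.propDecidable _) (w z) 0 := fun z => rfl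
  have hdet : ∀ x y : Fin n, DeterminedBy (openConnIn K x y : Set (BondConfig (Fin n))) D :=
    fun x y => IncStarCutVertex.determinedBy_openConnIn_offDiag K x y
  -- (1) restrict the weight to `K`
  rw [← sahiE3_restrict_eq_of_determinedBy w (hdet r a) (hdet r b) (hdet r c)]
  show 0 ≤ sahiE3 (prodBernoulli wK) (openConnIn K r a) (openConnIn K r b) (openConnIn K r c)
  -- (2) under `wK` the `K`-local events are a.s. the plain root connections
  set L : Set (Fin n) := K \ {r} with hL
  have hKL : insert r L = K := insert_diff_singleton_of_mem hr
  have hrL : r ∉ L := fun h => h.2 rfl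
  have hcross : ∀ x y : Fin n, x ∈ L → y ∉ L → y ≠ r → wK s(x, y) = 0 := by
    intro x y _ hy hyr
    have hyK : y ∉ K := not_mem_of_not_mem_diff_singleton hy hyr
    rw [hwKz, if_neg]
    intro hmem
    exact hyK (hmem.2 y (Sym2.mem_mk_right x y))
  set G : Set (BondConfig (Fin n)) := {ω | ∀ e, wK e = 0 → e ∉ ω}
  have hG1 : (prodBernoulli wK).real G = 1 := real_sureClosed wK
  have hωG : ∀ ω ∈ G, ∀ x y : Fin n, x ∈ L → y ∉ L → y ≠ r → s(x, y) ∉ ω :=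
    fun ω hω x y hx hy hyr => hω _ (hcross x y hx hy hyr)
  have hev : ∀ t : Fin n, t ∈ K → ∀ ω ∈ G, (ω ∈ openConnIn K r t ↔ ω ∈ openConn r t) := by
    intro t ht ω hω
    have h := bridge_conn_ll L hrL (hωG ω hω) (Set.mem_insert r L) (show t ∈ insert r L by rw [hKL]; exact ht)
    rw [hKL] at h
    exact h.symm
  rw [sahiE3_congr_of_sure MeasurableSet.of_discrete hG1 (hev a ha) (hev b hb) (hev c hc)]
  -- (3) gen 21 for the restricted weight: its environment is the `K`-local environment of `w`
  refine incStar_nonneg_of_apexUnicyclic wK r a b c z₀ (hforest.anti ?_)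
  intro x y hxy
  rw [SimpleGraph.deleteEdges_adj, SimpleGraph.fromEdgeSet_adj] at hxy
  obtain ⟨⟨⟨hrz, hwz⟩, hne⟩, hz⟩ := hxy
  rw [SimpleGraph.deleteEdges_adj, SimpleGraph.fromEdgeSet_adj]
  refine ⟨⟨⟨hrz, ?_⟩, hne⟩, hz⟩
  rw [hwKz] at hwz
  by_cases hmem : s(x, y) ∈ D
  · rw [if_pos hmem] at hwz; exact ⟨hmem.2, hwz⟩
  · rw [if_neg hmem] at hwz; exact absurd rfl hwz

/-! ### Targets separated by the root: any environment -/

/-- **Split targets need no hypothesis on cycles.**  Let `K ∋ s` be closed — no positive pair from `K ∖ {s}` to `Kᶜ` — with `a ∈ K`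
and `b, c ∉ K`.  Then `0 ≤ E₃({s↔a},{s↔b},{s↔c})`: a.s. `{s↔a}` lives on the pairs inside `K` and `{s↔b}, {s↔c}` on the pairs inside
`Kᶜ ∪ {s}`, the two sides are independent, and `E₃ = P(s↔a)·Cov(1_{s↔b}, 1_{s↔c}) ≥ 0` by Harris. (By the symmetry of `E₃` and
`K ↔ Kᶜ ∪ {s}` this covers every placement of the targets in at least two closed parts.) [this work] -/
theorem incStar_nonneg_of_target_split (w : Sym2 (Fin n) → unitInterval) {K : Set (Fin n)} {s a b c : Fin n}
    (hs : s ∈ K) (ha : a ∈ K) (hb : b ∉ K) (hc : c ∉ K)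
    (hK : ∀ x y : Fin n, x ∈ K → x ≠ s → y ∉ K → w s(x, y) = 0) :
    0 ≤ sahiE3 (prodBernoulli w) (openConn s a) (openConn s b) (openConn s c) := by
  set L : Set (Fin n) := K \ {s} with hL
  have hKL : insert s L = K := insert_diff_singleton_of_mem hs
  have hsL : s ∉ L := fun h => h.2 rfl
  have hs1 : s ∈ insert s L := Set.mem_insert s L
  have ha1 : a ∈ insert s L := by rw [hKL]; exact ha
  have hbL : b ∈ Lᶜ := fun h => hb h.1
  have hcL : c ∈ Lᶜ := fun h => hc h.1
  -- the almost-sure set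
  set G : Set (BondConfig (Fin n)) := {ω | ∀ e, w e = 0 → e ∉ ω}
  have hG1 : (prodBernoulli w).real G = 1 := real_sureClosed w
  have hωG : ∀ ω ∈ G, ∀ x y : Fin n, x ∈ L → y ∉ L → y ≠ s → s(x, y) ∉ ω :=
    fun ω hω x y hx hy hys => hω _ (hK x y hx.1 (fun h => hx.2 (Set.mem_singleton_iff.2 h))
      (not_mem_of_not_mem_diff_singleton hy hys))
  -- the factored events
  set A' : Set (BondConfig (Fin n)) := openConnIn (insert s L) s a
  set B' : Set (BondConfig (Fin n)) := openConnIn Lᶜ s b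
  set C' : Set (BondConfig (Fin n)) := openConnIn Lᶜ s c
  have hA : ∀ ω ∈ G, (ω ∈ openConn s a ↔ ω ∈ A') := fun ω hω => bridge_conn_ll L hsL (hωG ω hω) hs1 ha1
  have hfar : ∀ t : Fin n, t ∈ Lᶜ → ∀ ω ∈ G, (ω ∈ openConn s t ↔ ω ∈ openConnIn Lᶜ s t) := by
    intro t ht ω hω
    rw [bridge_conn_lr L hsL (hωG ω hω) hs1 ht]
    exact ⟨fun h => h.2, fun h => ⟨⟨hs1, hs1, SimpleGraph.Reachable.refl _⟩, h⟩⟩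
  rw [sahiE3_congr_of_sure MeasurableSet.of_discrete hG1 hA (hfar b hbL) (hfar c hcL)]
  -- independence of the two sides
  have hdA : DeterminedBy A' {z : Sym2 (Fin n) | ¬ z.IsDiag ∧ ∀ x ∈ z, x ∈ insert s L} :=
    IncStarCutVertex.determinedBy_openConnIn_offDiag _ s a
  have hdB : DeterminedBy B' {z : Sym2 (Fin n) | ¬ z.IsDiag ∧ ∀ x ∈ z, x ∈ Lᶜ} :=
    IncStarCutVertex.determinedBy_openConnIn_offDiag _ s b
  have hdC : DeterminedBy C' {z : Sym2 (Fin n) | ¬ z.IsDiag ∧ ∀ x ∈ z, x ∈ Lᶜ} :=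
    IncStarCutVertex.determinedBy_openConnIn_offDiag _ s c
  have iAB : (prodBernoulli w).real (A' ∩ B') = (prodBernoulli w).real A' * (prodBernoulli w).real B' :=
    indep_blocks w L s hdA hdB
  have iAC : (prodBernoulli w).real (A' ∩ C') = (prodBernoulli w).real A' * (prodBernoulli w).real C' :=
    indep_blocks w L s hdA hdC
  have iABC : (prodBernoulli w).real (A' ∩ B' ∩ C')
      = (prodBernoulli w).real A' * (prodBernoulli w).real (B' ∩ C') := by
    rw [Set.inter_assoc]; exact indep_blocks w L s hdA (hdB.inter hdC)
  -- Harris on the far side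
  have harris : (prodBernoulli w).real B' * (prodBernoulli w).real C' ≤ (prodBernoulli w).real (B' ∩ C') :=
    prodBernoulli_harris w (isUpperSet_openConnIn _ _ _) (isUpperSet_openConnIn _ _ _)
      MeasurableSet.of_discrete MeasurableSet.of_discrete
  have hA0 : 0 ≤ (prodBernoulli w).real A' := measureReal_nonneg
  have key : sahiE3 (prodBernoulli w) A' B' C'
      = (prodBernoulli w).real A' * ((prodBernoulli w).real (B' ∩ C') - (prodBernoulli w).real B' * (prodBernoulli w).real C') := by
    rw [sahiE3_def, iABC, iAB, iAC]; ring
  rw [key]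
  exact mul_nonneg hA0 (by linarith)

/-! ### All targets in one closed part with at most one cycle -/

/-- **Local apex-unicyclic theorem.**  Let `K ∋ s` be closed (no positive pair from `K ∖ {s}` to `Kᶜ`) and contain the targets
`a, b, c`.  If the positive pairs inside `K` avoiding `s` form a forest after deleting one pair `z₀`, then
`0 ≤ E₃({s↔a},{s↔b},{s↔c})` — the cycles of the environment outside `K` do not matter. [this work] -/
theorem incStar_nonneg_of_localUnicyclic (w : Sym2 (Fin n) → unitInterval) {K : Set (Fin n)} {s a b c : Fin n}
    (hs : s ∈ K) (ha : a ∈ K) (hb : b ∈ K) (hc : c ∈ K)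
    (hK : ∀ x y : Fin n, x ∈ K → x ≠ s → y ∉ K → w s(x, y) = 0) (z₀ : Sym2 (Fin n))
    (hforest : ((SimpleGraph.fromEdgeSet {z : Sym2 (Fin n) | s ∉ z ∧ (∀ v ∈ z, v ∈ K) ∧ w z ≠ 0}).deleteEdges {z₀}).IsAcyclic) :
    0 ≤ sahiE3 (prodBernoulli w) (openConn s a) (openConn s b) (openConn s c) := by
  set L : Set (Fin n) := K \ {s} with hL
  have hKL : insert s L = K := insert_diff_singleton_of_mem hs
  have hsL : s ∉ L := fun h => h.2 rfl
  set G : Set (BondConfig (Fin n)) := {ω | ∀ e, w e = 0 → e ∉ ω}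
  have hG1 : (prodBernoulli w).real G = 1 := real_sureClosed w
  have hωG : ∀ ω ∈ G, ∀ x y : Fin n, x ∈ L → y ∉ L → y ≠ s → s(x, y) ∉ ω :=
    fun ω hω x y hx hy hys => hω _ (hK x y hx.1 (fun h => hx.2 (Set.mem_singleton_iff.2 h))
      (not_mem_of_not_mem_diff_singleton hy hys))
  have hev : ∀ t : Fin n, t ∈ K → ∀ ω ∈ G, (ω ∈ openConn s t ↔ ω ∈ openConnIn K s t) := by
    intro t ht ω hω
    have h := bridge_conn_ll L hsL (hωG ω hω) (Set.mem_insert s L) (show t ∈ insert s L by rw [hKL]; exact ht)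
    rwa [hKL] at h
  rw [sahiE3_congr_of_sure MeasurableSet.of_discrete hG1 (hev a ha) (hev b hb) (hev c hc)]
  exact incStar_openConnIn_nonneg_of_apexUnicyclic w hs ha hb hc z₀ hforest

/-! ### Block composition at a cut vertex -/

/-- **Two apex-unicyclic blocks glued at a cut vertex.**  Let `V₁ ∩ V₂ = {x}`, `V₁ ∪ V₂ = everything`, root `s ∈ V₁`, and no positive
pair between `V₁ ∖ {x}` and `V₂ ∖ {x}`.  If the positive pairs inside `V₁` avoiding `s` have at most one cycle (a forest after deleting
`z₁`) and the positive pairs inside `V₂` avoiding `x` have at most one cycle (a forest after deleting `z₂`), then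
`0 ≤ E₃({s↔a},{s↔b},{s↔c})` for all targets. (The environment of `w` at `s` may have many more cycles: those of `V₂` through `x`.)
Proof: gen 8's cut-vertex composition `IncStarCutVertex.incStar_of_cutVertex` with the relative theorem on both blocks. [this work] -/
theorem incStar_nonneg_of_cutVertex_apexUnicyclic (w : Sym2 (Fin n) → unitInterval) {V₁ V₂ : Set (Fin n)} {x s : Fin n}
    (hV : ∀ y, y ∈ V₁ → y ∈ V₂ → y = x) (hx₁ : x ∈ V₁) (hx₂ : x ∈ V₂) (hs : s ∈ V₁) (huniv : ∀ y, y ∈ V₁ ∪ V₂)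
    (hw : ∀ y z : Fin n, y ∈ V₁ → z ∈ V₂ → y ≠ x → z ≠ x → w s(y, z) = 0)
    (z₁ : Sym2 (Fin n))
    (h₁ : ((SimpleGraph.fromEdgeSet {z : Sym2 (Fin n) | s ∉ z ∧ (∀ v ∈ z, v ∈ V₁) ∧ w z ≠ 0}).deleteEdges {z₁}).IsAcyclic)
    (z₂ : Sym2 (Fin n))
    (h₂ : ((SimpleGraph.fromEdgeSet {z : Sym2 (Fin n) | x ∉ z ∧ (∀ v ∈ z, v ∈ V₂) ∧ w z ≠ 0}).deleteEdges {z₂}).IsAcyclic)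
    (a b c : Fin n) :
    0 ≤ sahiE3 (prodBernoulli w) (openConn s a) (openConn s b) (openConn s c) :=
  IncStarCutVertex.incStar_of_cutVertex w hV hx₁ hx₂ hs huniv hw
    (fun _ _ _ ht₁ ht₂ ht₃ => incStar_openConnIn_nonneg_of_apexUnicyclic w hs ht₁ ht₂ ht₃ z₁ h₁)
    (fun _ _ _ ht₁ ht₂ ht₃ => incStar_openConnIn_nonneg_of_apexUnicyclic w hx₂ ht₁ ht₂ ht₃ z₂ h₂) a b c

/-- **Relative block composition** (to iterate along a block–cut tree): same gluing, conclusion for the events inside `V₁ ∪ V₂`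
without assuming `V₁ ∪ V₂` is everything. [this work] -/
theorem incStar_openConnIn_nonneg_of_cutVertex_apexUnicyclic (w : Sym2 (Fin n) → unitInterval) {V₁ V₂ : Set (Fin n)}
    {x s : Fin n} (hV : ∀ y, y ∈ V₁ → y ∈ V₂ → y = x) (hx₁ : x ∈ V₁) (hx₂ : x ∈ V₂) (hs : s ∈ V₁)
    (hw : ∀ y z : Fin n, y ∈ V₁ → z ∈ V₂ → y ≠ x → z ≠ x → w s(y, z) = 0)
    (z₁ : Sym2 (Fin n))
    (h₁ : ((SimpleGraph.fromEdgeSet {z : Sym2 (Fin n) | s ∉ z ∧ (∀ v ∈ z, v ∈ V₁) ∧ w z ≠ 0}).deleteEdges {z₁}).IsAcyclic)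
    (z₂ : Sym2 (Fin n))
    (h₂ : ((SimpleGraph.fromEdgeSet {z : Sym2 (Fin n) | x ∉ z ∧ (∀ v ∈ z, v ∈ V₂) ∧ w z ≠ 0}).deleteEdges {z₂}).IsAcyclic)
    {a b c : Fin n} (ha : a ∈ V₁ ∪ V₂) (hb : b ∈ V₁ ∪ V₂) (hc : c ∈ V₁ ∪ V₂) :
    0 ≤ sahiE3 (prodBernoulli w) (openConnIn (V₁ ∪ V₂) s a) (openConnIn (V₁ ∪ V₂) s b) (openConnIn (V₁ ∪ V₂) s c) :=
  IncStarCutVertex.incStar_openConnIn_of_cutVertex w hV hx₁ hx₂ hs hw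
    (fun _ _ _ ht₁ ht₂ ht₃ => incStar_openConnIn_nonneg_of_apexUnicyclic w hs ht₁ ht₂ ht₃ z₁ h₁)
    (fun _ _ _ ht₁ ht₂ ht₃ => incStar_openConnIn_nonneg_of_apexUnicyclic w hx₂ ht₁ ht₂ ht₃ z₂ h₂) ha hb hc

end IncStar

end Summit.CriticalPhenomena.PercolationContinuityZ3.Theorems
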